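import Literature.MathematicalPhysics.QuantumLattice.PairFieldYangCeiling
import HarnessLib

/-!
# Yang's ceiling on the `d_{x²-y²}` pair-field order parameter, in the format of the summit `hubbard.S01`

Companion of `PairFieldYangCeiling` (Yang's bound for Scalapino's pair field,
`Re ⟨ψ, Δ_d† Δ_d ψ⟩ ≤ 2N(2L² - N + 2) ‖ψ‖²` for every `N`-particle torus state). Here the bound is
cast in the exact format of the order functional of `Literature.Hubbard.DWaveSuperconductivityHubbard`
(the summit `HubbardSuperconductivity`): for ANY sequence of normalised torus states of particle
number `N L = 2⌊(1-δ)L²/2⌋` at even sides (no Hamiltonian, no ground-state property),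
`liminf_k |Λ_{2k}|⁻² Σ_{x,y ∈ Λ_{2k}} torusPullback (pairFieldCorr g_d ψ) (2k) x y ≤ 2(1-δ)(1+δ)`
(`liminf_dWavePairFieldCorr_le_yang`). So every witness `(U, δ)` of the summit has order-parameter
density at most Yang's kinematic value `2(1 - δ²) < 2`; compare the dynamic weak-coupling ceiling
`10⁵·U·log²(4 + 32/√U)` of `HubbardPairDensityCouplingCeilingUniform` (ground states only).

Sources: C. N. Yang, Rev. Mod. Phys. 34 (1962) 694, §3–§4; D. J. Scalapino, Phys. Rep. 250 (1995)
329, §2 eq. (2.4); S. Friedli, Y. Velenik, *Statistical Mechanics of Lattice Systems* (2017) §3.7.2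
(LRO as a `liminf`). Proof-only; no definition, no named fact.
-/

namespace Literature.MathematicalPhysics.QuantumLattice

open Matrix Finset
open scoped ComplexOrder

/-! ### The ceiling in the format of the summit statement `hubbard.S01` -/

section SummitFormat

open Filter Literature.Probability.LatticeModels

/-- **Yang's ceiling on the summit's order functional.** Let `δ ∈ [0, 1]` and let `N`, `ψ` be ANY
particle numbers and torus states with, at every even side `L`, `N L = 2⌊(1-δ)L²/2⌋`, `ψ L`
normalised and of particle number `N L` (no Hamiltonian, no ground-state property). Then the
sequence whose `liminf` the summit `HubbardSuperconductivity` asks to be positive obeys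
`liminf_k |Λ_{2k}|⁻² Σ_{x,y ∈ Λ_{2k}} torusPullback (pairFieldCorr g_d ψ) (2k) x y ≤ 2(1-δ)(1+δ)`,
`Λ_{2k} = halfOpenBox 2 (2k)`: the `d_{x²-y²}` pair-field order-parameter density of any sequence of
states of hole doping `δ` is at most Yang's value `2(1 - δ²)`. (The `k`-th term is
`(2k)⁻⁴ Re ⟨ψ_{2k}, Δ_d† Δ_d ψ_{2k}⟩` by `torusLROSeq_pairFieldCorr_succ`, it is `≥ 0`, and by
`re_expect_pairField_dWave_conjTranspose_mul_le_yang` it is `≤ 2(1-δ)(1+δ) + 4(1-δ)/(2k)²`.)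
Yang, Rev. Mod. Phys. 34 (1962) 694, §3–§4; Scalapino, Phys. Rep. 250 (1995) 329, §2 eq. (2.4);
Friedli–Velenik (2017) §3.7.2. [folklore] -/
theorem liminf_dWavePairFieldCorr_le_yang {δ : ℝ} (hδ0 : 0 ≤ δ) (hδ1 : δ ≤ 1) (N : ℕ → ℕ)
    (ψ : ∀ L, Fock (Orb (FermionTorus 2 L)))
    (hψ : ∀ L, Even L → N L = 2 * ⌊(1 - δ) * (L : ℝ) ^ 2 / 2⌋₊ ∧ star (ψ L) ⬝ᵥ ψ L = 1 ∧
      IsNParticle (N L) (ψ L)) :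
    liminf (fun k : ℕ => (∑ x ∈ halfOpenBox 2 (2 * k), ∑ y ∈ halfOpenBox 2 (2 * k),
        torusPullback (pairFieldCorr dWaveFormFactor ψ) (2 * k) x y) /
          ((#(halfOpenBox 2 (2 * k)) : ℝ)) ^ 2) atTop ≤
      2 * (1 - δ) * (1 + δ) := by
  set C : ℝ := 2 * (1 - δ) * (1 + δ) with hC
  set u : ℕ → ℝ := fun k => (∑ x ∈ halfOpenBox 2 (2 * k), ∑ y ∈ halfOpenBox 2 (2 * k),
      torusPullback (pairFieldCorr dWaveFormFactor ψ) (2 * k) x y) /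
        ((#(halfOpenBox 2 (2 * k)) : ℝ)) ^ 2 with hu
  change liminf u atTop ≤ C
  -- the `k`-th term for `k ≥ 1`, and its sign
  have hterm : ∀ k : ℕ, 1 ≤ k → ∃ n : ℕ, 2 * k = n + 1 ∧
      u k = (star (ψ (n + 1)) ⬝ᵥ (((pairField dWaveFormFactor (n + 1))ᴴ *
        pairField dWaveFormFactor (n + 1)) *ᵥ ψ (n + 1))).re / ((n + 1 : ℕ) : ℝ) ^ 4 := by
    intro k hk
    refine ⟨2 * k - 1, by omega, ?_⟩
    have e : 2 * k = (2 * k - 1) + 1 := by omega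
    simp only [hu]
    rw [e, torusLROSeq_pairFieldCorr_succ]
    rfl
  have hnonneg : ∀ k : ℕ, 1 ≤ k → 0 ≤ u k := by
    intro k hk
    obtain ⟨n, -, hn⟩ := hterm k hk
    rw [hn]
    refine div_nonneg ?_ (by positivity)
    exact (posSemidef_conjTranspose_mul_self (pairField dWaveFormFactor (n + 1))).re_dotProduct_nonneg
      (ψ (n + 1))
  have hbdd : IsBoundedUnder (· ≥ ·) atTop u :=
    isBoundedUnder_of_eventually_ge (a := 0)
      (Filter.eventually_atTop.2 ⟨1, fun k hk => hnonneg k hk⟩)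
  -- for every `c > C`, eventually `u k ≤ c`
  have hev : ∀ c : ℝ, C < c → ∀ᶠ k in atTop, u k ≤ c := by
    intro c hc
    have hε : 0 < c - C := by linarith
    rw [Filter.eventually_atTop]
    refine ⟨⌈4 / (c - C)⌉₊ + 2, fun k hk => ?_⟩
    obtain ⟨n, hn2, hn⟩ := hterm k (by omega)
    obtain ⟨hN, hnorm, hNP⟩ := hψ (n + 1) ⟨k, by omega⟩
    rw [hN] at hNP
    haveI : NeZero (n + 1) := ⟨by omega⟩
    have hL3 : 3 ≤ n + 1 := by omega
    -- Yang's bound on the term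
    have hNle : ((2 * ⌊(1 - δ) * ((n + 1 : ℕ) : ℝ) ^ 2 / 2⌋₊ : ℕ) : ℝ) ≤
        (1 - δ) * ((n + 1 : ℕ) : ℝ) ^ 2 := by
      have hy : 0 ≤ (1 - δ) * ((n + 1 : ℕ) : ℝ) ^ 2 / 2 := by
        have : (0 : ℝ) ≤ ((n + 1 : ℕ) : ℝ) ^ 2 := by positivity
        have : 0 ≤ 1 - δ := by linarith
        positivity
      have hfl := Nat.floor_le hy
      push_cast at hfl ⊢
      linarith
    have hL1 : (1 : ℝ) ≤ ((n + 1 : ℕ) : ℝ) := by exact_mod_cast (show 1 ≤ n + 1 by omega)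
    have hL2 : (0 : ℝ) < ((n + 1 : ℕ) : ℝ) ^ 2 := by positivity
    have hNL : 2 * ⌊(1 - δ) * ((n + 1 : ℕ) : ℝ) ^ 2 / 2⌋₊ ≤ 2 * (n + 1) ^ 2 := by
      have h : ((2 * ⌊(1 - δ) * ((n + 1 : ℕ) : ℝ) ^ 2 / 2⌋₊ : ℕ) : ℝ) ≤ 2 * ((n + 1 : ℕ) : ℝ) ^ 2 := by
        nlinarith
      exact_mod_cast h
    have hY := re_expect_pairField_dWave_conjTranspose_mul_le_yang (n + 1) hL3 (even_two_mul _) hNL hNP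
    rw [hnorm] at hY
    simp only [Complex.one_re, mul_one] at hY
    -- `2N(2L² - N + 2) ≤ 2(1-δ)L²((1+δ)L² + 2) ≤ (C + 4/L²) L⁴ ≤ c L⁴` for `L = n + 1 ≥ ⌈4/(c-C)⌉ + 2`
    have hmono : 2 * ((2 * ⌊(1 - δ) * ((n + 1 : ℕ) : ℝ) ^ 2 / 2⌋₊ : ℕ) : ℝ) *
        (2 * ((n + 1 : ℕ) : ℝ) ^ 2 - ((2 * ⌊(1 - δ) * ((n + 1 : ℕ) : ℝ) ^ 2 / 2⌋₊ : ℕ) : ℝ) + 2) ≤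
        2 * (1 - δ) * ((n + 1 : ℕ) : ℝ) ^ 2 * ((1 + δ) * ((n + 1 : ℕ) : ℝ) ^ 2 + 2) := by
      have hN0 : (0 : ℝ) ≤ ((2 * ⌊(1 - δ) * ((n + 1 : ℕ) : ℝ) ^ 2 / 2⌋₊ : ℕ) : ℝ) := Nat.cast_nonneg _
      have hy : (1 - δ) * ((n + 1 : ℕ) : ℝ) ^ 2 ≤ ((n + 1 : ℕ) : ℝ) ^ 2 := by nlinarith
      nlinarith [mul_nonneg (sub_nonneg.2 hNle) (by nlinarith :
        (0 : ℝ) ≤ 2 * ((n + 1 : ℕ) : ℝ) ^ 2 + 2 - ((2 * ⌊(1 - δ) * ((n + 1 : ℕ) : ℝ) ^ 2 / 2⌋₊ : ℕ) : ℝ) -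
          (1 - δ) * ((n + 1 : ℕ) : ℝ) ^ 2)]
    have hLk : (⌈4 / (c - C)⌉₊ : ℝ) + 2 ≤ ((n + 1 : ℕ) : ℝ) := by
      have : ⌈4 / (c - C)⌉₊ + 2 ≤ n + 1 := by omega
      exact_mod_cast this
    have hceil : 4 / (c - C) ≤ (⌈4 / (c - C)⌉₊ : ℝ) := Nat.le_ceil _
    have hdiv : 4 / (c - C) < ((n + 1 : ℕ) : ℝ) := by linarith
    have h4 : 4 < (c - C) * ((n + 1 : ℕ) : ℝ) := by
      have := (div_lt_iff₀ hε).1 hdiv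
      linarith
    rw [hn, div_le_iff₀ (by positivity)]
    refine hY.trans (hmono.trans ?_)
    have hδ' : 0 ≤ 1 - δ := by linarith
    -- `2(1-δ)L²((1+δ)L² + 2) = C L⁴ + 4(1-δ)L² ≤ C L⁴ + 4 L² ≤ C L⁴ + (c - C) L · L² ≤ c L⁴`
    have hsq : ((n + 1 : ℕ) : ℝ) ^ 4 = ((n + 1 : ℕ) : ℝ) ^ 2 * ((n + 1 : ℕ) : ℝ) ^ 2 := by ring
    rw [hsq]
    nlinarith [mul_le_mul_of_nonneg_right hL1 hL2.le, mul_nonneg hδ' hδ0]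
  -- conclude
  by_contra hlt
  push Not at hlt
  have hmid : C < (C + liminf u atTop) / 2 := by linarith
  have h := liminf_le_of_frequently_le ((hev _ hmid).frequently) hbdd
  linarith

end SummitFormat

end Literature.MathematicalPhysics.QuantumLattice
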